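import Mathlib.Analysis.SpecialFunctions.Pow.Real
import Mathlib.Analysis.MeanInequalitiesPow
import HarnessLib

/-!
# Soft extrema, `k`-level form: the power-mean soft minimum over a finite family of level ratios

Cell `pub-fluidc` (FLUID COMPUTER; host summit `NavierStokesRegularity`, negation side, machine paradigm), prover
seat p1 (gen 6 draft, gen 7 filing); companion of `FluidComputer.SoftExtrema` (the two-ratio relay objective of
RULING R35 row (d) / R44 (ii)(b)), kept IMPORT-INDEPENDENT of it (Mathlib only — the hub carried no olean of that
module when this file was verified); the two files meet in the shared namespace. HONEST FRAMING: low prior, high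
value-of-information experiment on Tao's machine paradigm; NOT a claim that NS blows up. Nothing in this file is
about the Navier–Stokes equations: elementary real analysis of one smooth surrogate of `min` on finitely many
positive reals.

A `k`-level relay (the machine paradigm needs arbitrarily many levels; the cell's ladder reads `r₁, r₂, r₃(out3i), …`)
would be ascended through the same smooth surrogate of `min` over ALL its level ratios:
`softMinN q s ρ = ((1/#s) ∑_{i∈s} ρᵢ^{-q})^{-1/q}`, the power mean of order `-q`. The bracket of the two-level file
persists with the factor `2^{1/q}` replaced by `(#s)^{1/q}`:

* `inf'_le_softMinN` / `softMinN_le_sup'` — it is a mean: `min ρ ≤ softMinN ≤ max ρ`;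
* `softMinN_le_mul_inf'` — `softMinN q s ρ ≤ (#s)^{1/q} · min ρ` (so at `q = 12` a TEN-level relay objective
  over-states its weakest level by at most `10^{1/12} < 1.22`, `ten_rpow_one_div_twelve_lt`);
* `le_inf'_of_le_softMinN` — the reading direction `x ≤ J ⇒ x / (#s)^{1/q} ≤ min ρ`;
* `softMinN_const` — on a constant family the surrogate is exact;
* `softMinN_anti` — the power-mean inequality in the order: `q ≤ q' ⇒ softMinN q' ≤ softMinN q` (a sharper order
  reads lower, so the registered `q = 12` value bounds every sharper surrogate from above, all of them above `min ρ`);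
* `tendsto_card_rpow_one_div` / `tendsto_softMinN_atTop` — the ZERO-TEMPERATURE LIMIT: `(#s)^{1/q} → 1` and hence
  `softMinN q s ρ → min ρ` as `q → ∞` (squeeze in the bracket): the order `q` trades smoothness of the ascent
  objective against fidelity to the weakest level, with the explicit price `(#s)^{1/q}`.

On two levels, unfolding both definitions gives `softMinN q univ ![a, b] = softMin q a b` of `FluidComputer.SoftExtrema`
(whose `tendsto_softMin_atTop` is the `#s = 2` case of the limit here); that identification is deliberately not stated
in this import-independent file.

0 sorry; axioms ⊆ {propext, Classical.choice, Quot.sound}; no named fact introduced.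
-/

noncomputable section

namespace Summit.NavierStokesRegularity.FluidComputer.SoftExtrema

open Real Finset Filter Topology

variable {ι : Type*}

/-- The power mean of order `-q` of a finite family: `softMinN q s ρ = ((∑_{i∈s} ρᵢ^{-q}) / #s)^{-1/q}`. -/
def softMinN (q : ℝ) (s : Finset ι) (ρ : ι → ℝ) : ℝ :=
  ((∑ i ∈ s, ρ i ^ (-q)) / s.card) ^ (-(1 / q))

/-- Ordered core: with `m = min ρ` and `M = max ρ` over `s` (all `ρᵢ > 0`), the mean of the `ρᵢ^{-q}` lies in
`[M^{-q}, m^{-q}]` and is at least `m^{-q} / #s`. -/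
theorem softMinN_bracket {q : ℝ} (hq : 0 < q) {s : Finset ι} (hs : s.Nonempty) {ρ : ι → ℝ}
    (hρ : ∀ i ∈ s, 0 < ρ i) :
    s.inf' hs ρ ≤ softMinN q s ρ ∧ softMinN q s ρ ≤ s.sup' hs ρ ∧
      softMinN q s ρ ≤ (s.card : ℝ) ^ (1 / q) * s.inf' hs ρ := by
  have hz : -(1 / q) ≤ 0 := by
    have : 0 < 1 / q := by positivity
    linarith
  have hq' : -q ≤ 0 := by linarith
  have hcard : (0 : ℝ) < s.card := by exact_mod_cast hs.card_pos
  obtain ⟨i₀, hi₀, hmin⟩ := Finset.exists_mem_eq_inf' hs ρ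
  obtain ⟨i₁, hi₁, hmax⟩ := Finset.exists_mem_eq_sup' hs ρ
  have hm : 0 < s.inf' hs ρ := by rw [hmin]; exact hρ i₀ hi₀
  have hM : 0 < s.sup' hs ρ := by rw [hmax]; exact hρ i₁ hi₁
  have hA : 0 < s.inf' hs ρ ^ (-q) := Real.rpow_pos_of_pos hm _
  have hB : 0 < s.sup' hs ρ ^ (-q) := Real.rpow_pos_of_pos hM _
  -- termwise: (max ρ)^{-q} ≤ ρᵢ^{-q} ≤ (min ρ)^{-q}
  have hterm : ∀ i ∈ s, ρ i ^ (-q) ≤ s.inf' hs ρ ^ (-q) ∧ s.sup' hs ρ ^ (-q) ≤ ρ i ^ (-q) := fun i hi =>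
    ⟨Real.rpow_le_rpow_of_nonpos hm (Finset.inf'_le ρ hi) hq',
      Real.rpow_le_rpow_of_nonpos (hρ i hi) (Finset.le_sup' ρ hi) hq'⟩
  have hsum_le : ∑ i ∈ s, ρ i ^ (-q) ≤ s.card * s.inf' hs ρ ^ (-q) := by
    have := Finset.sum_le_card_nsmul s (fun i => ρ i ^ (-q)) _ (fun i hi => (hterm i hi).1)
    rwa [nsmul_eq_mul] at this
  have hle_sum : (s.card : ℝ) * s.sup' hs ρ ^ (-q) ≤ ∑ i ∈ s, ρ i ^ (-q) := by
    have := Finset.card_nsmul_le_sum s (fun i => ρ i ^ (-q)) _ (fun i hi => (hterm i hi).2)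
    rwa [nsmul_eq_mul] at this
  have hsingle : s.inf' hs ρ ^ (-q) ≤ ∑ i ∈ s, ρ i ^ (-q) := by
    have h := Finset.single_le_sum (f := fun i => ρ i ^ (-q)) (fun i hi => (Real.rpow_pos_of_pos (hρ i hi) _).le) hi₀
    rw [hmin]
    exact h
  -- the mean μ of the ρᵢ^{-q}
  have hμA : (∑ i ∈ s, ρ i ^ (-q)) / s.card ≤ s.inf' hs ρ ^ (-q) := by
    rw [div_le_iff₀ hcard, mul_comm]; exact hsum_le
  have hBμ : s.sup' hs ρ ^ (-q) ≤ (∑ i ∈ s, ρ i ^ (-q)) / s.card := by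
    rw [le_div_iff₀ hcard, mul_comm]; exact hle_sum
  have hμ : 0 < (∑ i ∈ s, ρ i ^ (-q)) / s.card := lt_of_lt_of_le hB hBμ
  have hAμ : s.inf' hs ρ ^ (-q) / s.card ≤ (∑ i ∈ s, ρ i ^ (-q)) / s.card :=
    div_le_div_of_nonneg_right hsingle hcard.le
  -- undoing the two exponents: (x^{-q})^{-1/q} = x (the identity `SoftExtrema.rpow_neg_rpow_neg_one_div`, inlined)
  have hexp : -q * -(1 / q) = 1 := by field_simp
  have hAa : (s.inf' hs ρ ^ (-q)) ^ (-(1 / q)) = s.inf' hs ρ := by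
    rw [← Real.rpow_mul hm.le, hexp, Real.rpow_one]
  have hBb : (s.sup' hs ρ ^ (-q)) ^ (-(1 / q)) = s.sup' hs ρ := by
    rw [← Real.rpow_mul hM.le, hexp, Real.rpow_one]
  unfold softMinN
  refine ⟨?_, ?_, ?_⟩
  · calc s.inf' hs ρ = (s.inf' hs ρ ^ (-q)) ^ (-(1 / q)) := hAa.symm
      _ ≤ ((∑ i ∈ s, ρ i ^ (-q)) / s.card) ^ (-(1 / q)) := Real.rpow_le_rpow_of_nonpos hμ hμA hz
  · calc ((∑ i ∈ s, ρ i ^ (-q)) / s.card) ^ (-(1 / q)) ≤ (s.sup' hs ρ ^ (-q)) ^ (-(1 / q)) :=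
          Real.rpow_le_rpow_of_nonpos hB hBμ hz
      _ = s.sup' hs ρ := hBb
  · have h1 : ((∑ i ∈ s, ρ i ^ (-q)) / s.card) ^ (-(1 / q)) ≤ (s.inf' hs ρ ^ (-q) / s.card) ^ (-(1 / q)) :=
      Real.rpow_le_rpow_of_nonpos (by positivity) hAμ hz
    have h2 : (s.inf' hs ρ ^ (-q) / s.card) ^ (-(1 / q)) = (s.card : ℝ) ^ (1 / q) * s.inf' hs ρ := by
      rw [Real.div_rpow hA.le hcard.le, hAa, Real.rpow_neg hcard.le, div_eq_mul_inv, inv_inv, mul_comm]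
    exact h1.trans_eq h2

/-- The `k`-level soft minimum is at least the weakest level ratio. -/
theorem inf'_le_softMinN {q : ℝ} (hq : 0 < q) {s : Finset ι} (hs : s.Nonempty) {ρ : ι → ℝ}
    (hρ : ∀ i ∈ s, 0 < ρ i) : s.inf' hs ρ ≤ softMinN q s ρ :=
  (softMinN_bracket hq hs hρ).1

/-- … and at most the strongest one (it is a mean). -/
theorem softMinN_le_sup' {q : ℝ} (hq : 0 < q) {s : Finset ι} (hs : s.Nonempty) {ρ : ι → ℝ}
    (hρ : ∀ i ∈ s, 0 < ρ i) : softMinN q s ρ ≤ s.sup' hs ρ :=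
  (softMinN_bracket hq hs hρ).2.1

/-- The `k`-level bracket: `softMinN q s ρ ≤ (#s)^{1/q} · min ρ`. -/
theorem softMinN_le_mul_inf' {q : ℝ} (hq : 0 < q) {s : Finset ι} (hs : s.Nonempty) {ρ : ι → ℝ}
    (hρ : ∀ i ∈ s, 0 < ρ i) : softMinN q s ρ ≤ (s.card : ℝ) ^ (1 / q) * s.inf' hs ρ :=
  (softMinN_bracket hq hs hρ).2.2

/-- The soft minimum of positive ratios is positive. -/
theorem softMinN_pos {q : ℝ} (hq : 0 < q) {s : Finset ι} (hs : s.Nonempty) {ρ : ι → ℝ}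
    (hρ : ∀ i ∈ s, 0 < ρ i) : 0 < softMinN q s ρ := by
  obtain ⟨i₀, hi₀, hmin⟩ := Finset.exists_mem_eq_inf' hs ρ
  have hm : 0 < s.inf' hs ρ := by rw [hmin]; exact hρ i₀ hi₀
  exact hm.trans_le (inf'_le_softMinN hq hs hρ)

/-- Reading direction: a value certified below the `k`-level soft objective certifies a floor under the weakest level,
`x ≤ softMinN q s ρ ⇒ x / (#s)^{1/q} ≤ min ρ`. -/
theorem le_inf'_of_le_softMinN {q x : ℝ} (hq : 0 < q) {s : Finset ι} (hs : s.Nonempty) {ρ : ι → ℝ}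
    (hρ : ∀ i ∈ s, 0 < ρ i) (hx : x ≤ softMinN q s ρ) :
    x / (s.card : ℝ) ^ (1 / q) ≤ s.inf' hs ρ := by
  have hcard : (0 : ℝ) < s.card := by exact_mod_cast hs.card_pos
  have hk : 0 < (s.card : ℝ) ^ (1 / q) := Real.rpow_pos_of_pos hcard _
  rw [div_le_iff₀ hk, mul_comm]
  exact hx.trans (softMinN_le_mul_inf' hq hs hρ)

/-- On a constant positive family the surrogate is exact: `softMinN q s (fun _ ↦ c) = c` (`q ≠ 0`, `s` nonempty). -/
theorem softMinN_const {q c : ℝ} (hq : q ≠ 0) {s : Finset ι} (hs : s.Nonempty) (hc : 0 ≤ c) :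
    softMinN q s (fun _ => c) = c := by
  have hcard : (s.card : ℝ) ≠ 0 := by exact_mod_cast hs.card_pos.ne'
  unfold softMinN
  rw [Finset.sum_const, nsmul_eq_mul, mul_div_cancel_left₀ _ hcard, ← Real.rpow_mul hc]
  have hexp : -q * -(1 / q) = 1 := by field_simp
  rw [hexp, Real.rpow_one]

/-- POWER-MEAN INEQUALITY in the order: for `0 < q ≤ q'` the sharper surrogate reads lower,
`softMinN q' s ρ ≤ softMinN q s ρ` (Jensen for `t ↦ t^{q'/q}` on the mean of the `ρᵢ^{-q}`). -/
theorem softMinN_anti {q q' : ℝ} (hq : 0 < q) (hqq' : q ≤ q') {s : Finset ι} (hs : s.Nonempty) {ρ : ι → ℝ}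
    (hρ : ∀ i ∈ s, 0 < ρ i) : softMinN q' s ρ ≤ softMinN q s ρ := by
  have hq' : 0 < q' := hq.trans_le hqq'
  have hcard : (0 : ℝ) < s.card := by exact_mod_cast hs.card_pos
  set p : ℝ := q' / q with hp_def
  have hp : 1 ≤ p := by rw [hp_def, le_div_iff₀ hq, one_mul]; exact hqq'
  -- the two means
  set A : ℝ := (∑ i ∈ s, ρ i ^ (-q)) / s.card with hA_def
  set B : ℝ := (∑ i ∈ s, ρ i ^ (-q')) / s.card with hB_def
  have hA : 0 < A := div_pos (Finset.sum_pos (fun i hi => Real.rpow_pos_of_pos (hρ i hi) _) hs) hcard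
  have hB : 0 < B := div_pos (Finset.sum_pos (fun i hi => Real.rpow_pos_of_pos (hρ i hi) _) hs) hcard
  -- Jensen: A^p ≤ B
  have hJ : A ^ p ≤ B := by
    have hw : ∀ i ∈ s, (0 : ℝ) ≤ 1 / s.card := fun _ _ => by positivity
    have hw' : ∑ i ∈ s, (1 : ℝ) / s.card = 1 := by
      rw [Finset.sum_const, nsmul_eq_mul]; field_simp
    have hz : ∀ i ∈ s, (0 : ℝ) ≤ ρ i ^ (-q) := fun i hi => (Real.rpow_pos_of_pos (hρ i hi) _).le
    have h := Real.rpow_arith_mean_le_arith_mean_rpow s (fun _ => (1 : ℝ) / s.card) (fun i => ρ i ^ (-q)) hw hw' hz hp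
    have hAe : ∑ i ∈ s, (1 : ℝ) / s.card * ρ i ^ (-q) = A := by
      rw [hA_def, ← Finset.mul_sum]; ring
    have hBe : ∑ i ∈ s, (1 : ℝ) / s.card * (ρ i ^ (-q)) ^ p = B := by
      have hterm : ∀ i ∈ s, (1 : ℝ) / s.card * (ρ i ^ (-q)) ^ p = (1 : ℝ) / s.card * ρ i ^ (-q') := by
        intro i hi
        rw [← Real.rpow_mul (hρ i hi).le]
        have : -q * p = -q' := by rw [hp_def]; field_simp
        rw [this]
      rw [Finset.sum_congr rfl hterm, ← Finset.mul_sum, hB_def]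
      ring
    rw [hAe, hBe] at h
    exact h
  -- apply the antitone map x ↦ x^{-1/q'} and recombine the exponents
  have hz : -(1 / q') ≤ 0 := by
    have : 0 < 1 / q' := by positivity
    linarith
  have h1 : B ^ (-(1 / q')) ≤ (A ^ p) ^ (-(1 / q')) := Real.rpow_le_rpow_of_nonpos (Real.rpow_pos_of_pos hA _) hJ hz
  have h2 : (A ^ p) ^ (-(1 / q')) = A ^ (-(1 / q)) := by
    rw [← Real.rpow_mul hA.le]
    have : p * -(1 / q') = -(1 / q) := by rw [hp_def]; field_simp
    rw [this]
  unfold softMinN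
  rw [← hA_def, ← hB_def, ← h2]
  exact h1

/-- The price factor disappears at zero temperature: `(#s)^{1/q} → 1` as `q → ∞` (`s` nonempty). -/
theorem tendsto_card_rpow_one_div {s : Finset ι} (hs : s.Nonempty) :
    Tendsto (fun q : ℝ => (s.card : ℝ) ^ (1 / q)) atTop (𝓝 1) := by
  have hcard : (0 : ℝ) < s.card := by exact_mod_cast hs.card_pos
  have h1 : Tendsto (fun q : ℝ => Real.log s.card * q⁻¹) atTop (𝓝 (Real.log s.card * 0)) :=
    tendsto_inv_atTop_zero.const_mul _
  rw [mul_zero] at h1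
  have h2 : Tendsto (fun q : ℝ => Real.exp (Real.log s.card * q⁻¹)) atTop (𝓝 (Real.exp 0)) :=
    (Real.continuous_exp.tendsto 0).comp h1
  rw [Real.exp_zero] at h2
  refine h2.congr (fun q => ?_)
  rw [Real.rpow_def_of_pos hcard, one_div]

/-- ZERO-TEMPERATURE LIMIT: the `k`-level soft minimum recovers the true weakest level, `softMinN q s ρ → min ρ` as
`q → ∞` (squeeze between `min ρ` and `(#s)^{1/q} · min ρ`). -/
theorem tendsto_softMinN_atTop {s : Finset ι} (hs : s.Nonempty) {ρ : ι → ℝ} (hρ : ∀ i ∈ s, 0 < ρ i) :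
    Tendsto (fun q : ℝ => softMinN q s ρ) atTop (𝓝 (s.inf' hs ρ)) := by
  have hup : Tendsto (fun q : ℝ => (s.card : ℝ) ^ (1 / q) * s.inf' hs ρ) atTop (𝓝 (s.inf' hs ρ)) := by
    have := (tendsto_card_rpow_one_div hs).mul_const (s.inf' hs ρ)
    simpa only [one_mul] using this
  refine tendsto_of_tendsto_of_tendsto_of_le_of_le' tendsto_const_nhds hup ?_ ?_
  · filter_upwards [eventually_gt_atTop (0 : ℝ)] with q hq using inf'_le_softMinN hq hs hρ
  · filter_upwards [eventually_gt_atTop (0 : ℝ)] with q hq using softMinN_le_mul_inf' hq hs hρ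

/-- Numeric anchor for a ten-level relay at the registered order: `10^{1/12} < 1.22`. -/
theorem ten_rpow_one_div_twelve_lt : (10 : ℝ) ^ (1 / 12 : ℝ) < 1.22 := by
  have h : (1 / 12 : ℝ) = (12 : ℝ)⁻¹ := by norm_num
  rw [h, Real.rpow_inv_lt_iff_of_pos (by norm_num) (by norm_num) (by norm_num)]
  have h12 : (1.22 : ℝ) ^ (12 : ℝ) = (1.22 : ℝ) ^ (12 : ℕ) := by
    rw [show (12 : ℝ) = ((12 : ℕ) : ℝ) by norm_num, Real.rpow_natCast]
  rw [h12]
  norm_num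

/-- Hence at `q = 12` a TEN-level relay objective over-states its weakest level by less than 22 %:
`softMinN 12 s ρ < 1.22 · min ρ` whenever `#s = 10`. -/
theorem softMinN_twelve_lt_of_card_ten {s : Finset ι} (hs : s.card = 10) {ρ : ι → ℝ} (hρ : ∀ i ∈ s, 0 < ρ i) :
    softMinN 12 s ρ < 1.22 * s.inf' (Finset.card_pos.mp (by omega)) ρ := by
  have hne : s.Nonempty := Finset.card_pos.mp (by omega)
  obtain ⟨i₀, hi₀, hmin⟩ := Finset.exists_mem_eq_inf' hne ρ
  have hm : 0 < s.inf' hne ρ := by rw [hmin]; exact hρ i₀ hi₀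
  have h := softMinN_le_mul_inf' (by norm_num : (0 : ℝ) < 12) hne hρ
  rw [hs] at h
  push_cast at h
  exact h.trans_lt (mul_lt_mul_of_pos_right ten_rpow_one_div_twelve_lt hm)

end Summit.NavierStokesRegularity.FluidComputer.SoftExtrema

end
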